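import Literature.Computability.Complexity.StackItemLists
import HarnessLib

/-!
# Popping one item in time proportional to the item: the token-register while loop on `Com`

Trunk complexity toolkit, continuing `StackItemLists.lean` (items `encItem v s`, coded two bits
per payload bit plus a terminator, concatenated into list registers; `pushItem` in
`4|v| + 5` steps; `popItem` in `13|L| + 6` steps).  `popItem` there drains the WHOLE list
register (`|L|` = total length of the list), because the only loop of `Com` — `loop k ct cf`,
"pop register `k` until it is empty" — cannot be left early.  For algorithms whose running time
must be (quasi-)linear in the data actually touched (sorting, FFT passes, the stack-machine
realisation of Harvey's factoring algorithm), popping the first item must cost `O(|item|)`,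
independently of the rest of the list.  The standard device (a while loop driven by a *token
register* which the body refills to continue; cf. `StackWhile.lean` for `ACom`) gives exactly
that on `Com`:

* `Com.popItemFast` on `PFReg = {L, A, S, W}`: `W := [1]`; while `W` pops a token: pop the tag
  bit of `L`; tag `1`: move the payload bit to `A` and put the token back; tag `0`: read the
  sign bit into the flag register `S` and stop (no token);
* **`runs_popItemFast`**: from `L = encItem v s ++ rest`, `A = a`, `S = W = []` it ends with
  `L = rest`, `A = v ++ a`, `S = flag s`, `W = []` within `8|v| + 10` steps;
  `runs_popItemFast_nil`: on the empty list nothing happens (`6` steps).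

## References

* T. Nipkow, G. Klein, *Concrete Semantics with Isabelle/HOL*, Springer 2014, §7.2 (while
  loops in big-step semantics). (Not held; the construction is standard and fully proved here.)
* S. Arora, B. Barak, *Computational Complexity: A Modern Approach*, CUP 2009, §0.1
  (self-delimiting codes of tuples).
-/

namespace Literature.Computability.Complexity

open _root_.Computability

namespace Com

/-! ### Register file -/

/-- Registers of `popItemFast`: the list `L`, the payload `A`, the sign flag `S`, the loop
token `W`. [folklore] -/
inductive PFReg where
  | L | A | S | W
  deriving DecidableEq, Fintype, Repr

namespace PFReg

/-- Register files of `PFReg` by their four contents. [folklore] -/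
def file (l a s w : List Bool) : Regs PFReg
  | .L => l | .A => a | .S => s | .W => w

section
variable (l a s w v : List Bool)
/-- Reading `L`. [folklore] -/ @[simp] theorem file_L : file l a s w .L = l := rfl
/-- Reading `A`. [folklore] -/ @[simp] theorem file_A : file l a s w .A = a := rfl
/-- Reading `S`. [folklore] -/ @[simp] theorem file_S : file l a s w .S = s := rfl
/-- Reading `W`. [folklore] -/ @[simp] theorem file_W : file l a s w .W = w := rfl
/-- Writing `L`. [folklore] -/
@[simp] theorem update_file_L : Function.update (file l a s w) .L v = file v a s w := by
  funext r; cases r <;> rfl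
/-- Writing `A`. [folklore] -/
@[simp] theorem update_file_A : Function.update (file l a s w) .A v = file l v s w := by
  funext r; cases r <;> rfl
/-- Writing `S`. [folklore] -/
@[simp] theorem update_file_S : Function.update (file l a s w) .S v = file l a v w := by
  funext r; cases r <;> rfl
/-- Writing `W`. [folklore] -/
@[simp] theorem update_file_W : Function.update (file l a s w) .W v = file l a s v := by
  funext r; cases r <;> rfl
end

/-- Every register file is a `file`. [folklore] -/
theorem eq_file (R : Regs PFReg) : R = file (R .L) (R .A) (R .S) (R .W) := by
  funext r; cases r <;> rfl

end PFReg

open PFReg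

/-! ### The program -/

/-- One round of `popItemFast`: pop the tag bit of `L`; on tag `1` move the payload bit to `A`
and refill the token `W`; on tag `0` read the sign bit into `S` (and let the loop end); on an
empty `L` do nothing. [folklore] -/
def popFastBody : Com PFReg :=
  pop .L
    (pop .L (push .A true ;; push .W true) (push .A false ;; push .W true) skip)
    (pop .L (push .S true) skip skip)
    skip

/-- **`popItemFast`**: remove the first item of `L` into `A` (payload) and `S` (sign flag) in
time `O(|item|)`, by the token-register while loop over `popFastBody`. [folklore] -/
def popItemFast : Com PFReg :=
  push .W true ;; loop .W popFastBody skip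

/-! ### Simulation -/

/-- A payload round: `L = 1 b w` becomes `L = w`, `A := b :: A`, token refilled; `6` steps.
[folklore] -/
theorem runs_popFastBody_pair (b : Bool) (w a s : List Bool) :
    Runs popFastBody (file (true :: b :: w) a s []) (file w (b :: a) s [true]) 6 := by
  have inner : Runs (pop PFReg.L (push .A true ;; push .W true) (push .A false ;; push .W true) skip)
      (file (b :: w) a s []) (file w (b :: a) s [true]) 4 := by
    cases b
    · exact Runs.pop_false' _ _ (R := file (false :: w) a s []) (w := w) rfl (by simp)
        ((Runs.push' (R := file w a s []) (R' := file w (false :: a) s []) (by simp)).seq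
          (Runs.push' (R' := file w (false :: a) s [true]) (by simp)))
    · exact Runs.pop_true' _ _ (R := file (true :: w) a s []) (w := w) rfl (by simp)
        ((Runs.push' (R := file w a s []) (R' := file w (true :: a) s []) (by simp)).seq
          (Runs.push' (R' := file w (true :: a) s [true]) (by simp)))
  exact Runs.pop_true' _ _ (R := file (true :: b :: w) a s []) (w := b :: w) rfl (by simp) inner

/-- The terminator round: `L = 0 sb w` becomes `L = w`, `S := flag sb`, no token; `≤ 5` steps.
[folklore] -/
theorem runs_popFastBody_term (sb : Bool) (w a : List Bool) :
    Runs popFastBody (file (false :: sb :: w) a [] []) (file w a (flag sb) []) 5 := by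
  have inner : Runs (pop PFReg.L (push .S true) skip skip) (file (sb :: w) a [] [])
      (file w a (flag sb) []) 3 := by
    cases sb
    · exact (Runs.pop_false' _ _ (R := file (false :: w) a [] []) (w := w) rfl (by simp)
        (Runs.skip (file w a [] []))).of_eq (by simp [flag]) (by omega)
    · exact Runs.pop_true' _ _ (R := file (true :: w) a [] []) (w := w) rfl (by simp)
        (Runs.push' (R := file w a [] []) (R' := file w a (flag true) []) (by simp [flag]))
  exact Runs.pop_false' _ _ (R := file (false :: sb :: w) a [] []) (w := sb :: w) rfl (by simp) inner

/-- The token loop over a tagged payload `x` followed by the terminator: `8|x| + 9` steps,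
payload delivered reversed on top of `A`. [folklore] -/
theorem runs_popFast_loop (x : List Bool) : ∀ (w a : List Bool) (sb : Bool),
    Runs (loop PFReg.W popFastBody skip)
      (file ((x.flatMap fun b => [true, b]) ++ false :: sb :: w) a [] [true])
      (file w (x.reverse ++ a) (flag sb) []) (8 * x.length + 9) := by
  induction x with
  | nil =>
    intro w a sb
    have h1 := runs_popFastBody_term sb w a
    have h2 : Runs (loop PFReg.W popFastBody skip) (file w a (flag sb) []) (file w a (flag sb) []) 1 :=
      Runs.loop_nil _ _ rfl
    exact (Runs.loop_true' (R := file (false :: sb :: w) a [] [true]) (w := []) rfl (by simp) h1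
      h2).of_eq (by simp) (by simp)
  | cons b x ih =>
    intro w a sb
    have h1 := runs_popFastBody_pair b ((x.flatMap fun b => [true, b]) ++ false :: sb :: w) a []
    have h2 := ih w (b :: a) sb
    refine (Runs.loop_true'
      (R := file ((true :: b :: (x.flatMap fun b => [true, b])) ++ false :: sb :: w) a [] [true])
      (w := []) rfl (by simp) h1 h2).of_eq (by simp) ?_
    simp only [List.length_cons]
    omega

/-- **Effect and cost of `popItemFast`**: from `L = encItem v s ++ rest`, `A = a`, `S = W = []`,
it ends with `L = rest`, `A = v ++ a`, `S = flag s`, `W = []` within `8|v| + 10` steps — linear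
in the ITEM, whatever the length of `rest`. [folklore] -/
theorem runs_popItemFast (v : List Bool) (s : Bool) (rest a : List Bool) :
    Runs popItemFast (file (encItem v s ++ rest) a [] []) (file rest (v ++ a) (flag s) [])
      (8 * v.length + 10) := by
  have h0 : Runs (push PFReg.W true) (file (encItem v s ++ rest) a [] [])
      (file (encItem v s ++ rest) a [] [true]) 1 :=
    Runs.push' (R' := file (encItem v s ++ rest) a [] [true]) (by simp)
  have e : encItem v s ++ rest = (v.reverse.flatMap fun b => [true, b]) ++ false :: s :: rest := by
    simp [encItem]
  have h1 := runs_popFast_loop v.reverse rest a s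
  rw [List.reverse_reverse, List.length_reverse, ← e] at h1
  exact (h0.seq h1).of_eq rfl (by omega)

/-- On the empty list `popItemFast` changes nothing (`6` steps). [folklore] -/
theorem runs_popItemFast_nil (a : List Bool) :
    Runs popItemFast (file [] a [] []) (file [] a [] []) 6 := by
  have h0 : Runs (push PFReg.W true) (file [] a [] []) (file [] a [] [true]) 1 :=
    Runs.push' (R' := file [] a [] [true]) (by simp)
  have hb : Runs popFastBody (file [] a [] []) (file [] a [] []) 2 :=
    Runs.pop_nil _ _ (R := file [] a [] []) rfl (Runs.skip _)
  have hl : Runs (loop PFReg.W popFastBody skip) (file [] a [] []) (file [] a [] []) 1 :=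
    Runs.loop_nil _ _ rfl
  exact (h0.seq (Runs.loop_true' (R := file [] a [] [true]) (w := []) rfl (by simp) hb hl)).of_eq
    rfl (by omega)

end Com

end Literature.Computability.Complexity
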